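import Summits.Ventures.HodgeRepro2.SlashOperator
import Summits.Ventures.HodgeRepro2.InvariantVolume
import Summits.Ventures.HodgeRepro2.PeterssonPairing

/-!
# The slash operators are unitary for the Petersson density; weight 3 against the invariant volume

Kernel support for the blind cell pub-hodge-repro2 (seat p2), T5-ID §ID-4(b′).  Two pointwise
identities on the ball:

* `⟨f ∥_k α, g ∥_k α⟩_k(z) = ⟨f, g⟩_k(αz)` for `α ∈ U(2,1)` — the slash operators of row 87
  (`slash k α f z = j(α,z)^{-k} f(αz)`) are unitary for the polarised Petersson density of row 95 (the
  change of variables `z ↦ αz` on the quotient then gives the unitarity of the slash action on the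
  inner product — the measure-theoretic half is not formalised);
* `⟨f, g⟩_3(z) · volumeDensity(z) = f(z) \overline{g(z)}` — against the invariant volume density
  `(1 − ‖z‖²)^{-3}` of row 89, the weight-3 density is the plain product `f \overline{g}`: this is the
  dictionary «(2,0)-form pairing `∫ ω_f ∧ \overline{ω_g}` ↔ Petersson pairing of the weight-3
  coefficients against the invariant volume» (the exterior-algebra constant is not formalised).
-/

namespace Summit.Ventures.HodgeRepro2.ShimuraData

open Complex

/-- **Unitarity of the slash operators for the polarised Petersson density**:
`⟨f ∥_k α, g ∥_k α⟩_k(z) = ⟨f, g⟩_k(αz)` for `α ∈ U(2,1)` and `z ∈ 𝔹²`. -/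
theorem peterssonPair_slash (k : ℕ) {α : Matrix (Fin 3) (Fin 3) ℂ} (hα : IsInU21 α)
    (f g : (Fin 2 → ℂ) → ℂ) {z : Fin 2 → ℂ} (hz : z ∈ ball₂) :
    peterssonPair k (slash k α f) (slash k α g) z = peterssonPair k f g (ballAction α z) := by
  have hD : autFactor α z ≠ 0 := IsInU21.autFactor_ne_zero hα hz
  have hjj : autFactor α z * (starRingEnd ℂ) (autFactor α z) = ((‖autFactor α z‖ : ℝ) : ℂ) ^ 2 := by
    rw [Complex.mul_conj, Complex.normSq_eq_norm_sq]
    push_cast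
    ring
  have hjk : (autFactor α z ^ k)⁻¹ * (starRingEnd ℂ) ((autFactor α z ^ k)⁻¹)
      = ((((‖autFactor α z‖ ^ 2) ^ k)⁻¹ : ℝ) : ℂ) := by
    rw [map_inv₀, map_pow, ← mul_inv, ← mul_pow, hjj]
    push_cast
    ring
  unfold peterssonPair slash
  rw [one_sub_normSq₂_ballAction hα hz]
  have h1 : ((1 - normSq₂ z) / ‖autFactor α z‖ ^ 2) ^ k
      = (1 - normSq₂ z) ^ k * ((‖autFactor α z‖ ^ 2) ^ k)⁻¹ := by
    rw [div_pow, div_eq_mul_inv]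
  rw [h1]
  calc (autFactor α z ^ k)⁻¹ * f (ballAction α z) *
        ((starRingEnd ℂ) ((autFactor α z ^ k)⁻¹ * g (ballAction α z))) *
        (((1 - normSq₂ z) ^ k : ℝ) : ℂ)
      = ((autFactor α z ^ k)⁻¹ * (starRingEnd ℂ) ((autFactor α z ^ k)⁻¹)) *
          (f (ballAction α z) * (starRingEnd ℂ) (g (ballAction α z))) *
          (((1 - normSq₂ z) ^ k : ℝ) : ℂ) := by
        rw [map_mul]
        ring
    _ = f (ballAction α z) * (starRingEnd ℂ) (g (ballAction α z)) *
          (((1 - normSq₂ z) ^ k * ((‖autFactor α z‖ ^ 2) ^ k)⁻¹ : ℝ) : ℂ) := by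
        rw [hjk]
        push_cast
        ring

/-- The real version: the Petersson density of row 86 is slash-invariant,
`|f ∥_k α|² (1 − ‖z‖²)^k = |f(αz)|² (1 − ‖αz‖²)^k`. -/
theorem petersson_slash (k : ℕ) {α : Matrix (Fin 3) (Fin 3) ℂ} (hα : IsInU21 α)
    (f : (Fin 2 → ℂ) → ℂ) {z : Fin 2 → ℂ} (hz : z ∈ ball₂) :
    petersson k (slash k α f) z = petersson k f (ballAction α z) := by
  have h := peterssonPair_slash k hα f f hz
  rw [peterssonPair_self, peterssonPair_self] at h
  exact_mod_cast h

/-- On the ball the invariant volume density is positive. -/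
theorem volumeDensity_pos {z : Fin 2 → ℂ} (hz : z ∈ ball₂) : 0 < volumeDensity z := by
  unfold volumeDensity
  have h1 : 0 < 1 - normSq₂ z := sub_pos.mpr (normSq₂_lt_one hz)
  positivity

/-- **Weight 3 against the invariant volume**: `⟨f, g⟩_3(z) · (1 − ‖z‖²)^{-3} = f(z) \overline{g(z)}` on
the ball — the weight-3 Petersson density is the plain product `f \overline{g}` relative to the invariant
volume density of row 89. -/
theorem peterssonPair_three_mul_volumeDensity (f g : (Fin 2 → ℂ) → ℂ) {z : Fin 2 → ℂ}
    (hz : z ∈ ball₂) :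
    peterssonPair 3 f g z * ((volumeDensity z : ℝ) : ℂ) = f z * (starRingEnd ℂ) (g z) := by
  unfold peterssonPair volumeDensity
  have h1 : (1 - normSq₂ z) ^ 3 ≠ 0 := pow_ne_zero _ (sub_pos.mpr (normSq₂_lt_one hz)).ne'
  have h2 : (((1 - normSq₂ z) ^ 3 : ℝ) : ℂ) * ((((1 - normSq₂ z) ^ 3)⁻¹ : ℝ) : ℂ) = 1 := by
    rw [← Complex.ofReal_mul, mul_inv_cancel₀ h1, Complex.ofReal_one]
  calc f z * (starRingEnd ℂ) (g z) * (((1 - normSq₂ z) ^ 3 : ℝ) : ℂ) *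
        ((((1 - normSq₂ z) ^ 3)⁻¹ : ℝ) : ℂ)
      = f z * (starRingEnd ℂ) (g z) *
          ((((1 - normSq₂ z) ^ 3 : ℝ) : ℂ) * ((((1 - normSq₂ z) ^ 3)⁻¹ : ℝ) : ℂ)) := by ring
    _ = f z * (starRingEnd ℂ) (g z) := by rw [h2, mul_one]

/-- The real version for one form: `|f|² (1 − ‖z‖²)^3 · (1 − ‖z‖²)^{-3} = |f(z)|²`. -/
theorem petersson_three_mul_volumeDensity (f : (Fin 2 → ℂ) → ℂ) {z : Fin 2 → ℂ} (hz : z ∈ ball₂) :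
    petersson 3 f z * volumeDensity z = ‖f z‖ ^ 2 := by
  unfold petersson volumeDensity
  have h1 : (1 - normSq₂ z) ^ 3 ≠ 0 := pow_ne_zero _ (sub_pos.mpr (normSq₂_lt_one hz)).ne'
  rw [mul_assoc, mul_inv_cancel₀ h1, mul_one]

/-- Unitarity transported through the invariant volume: for `α ∈ U(2,1)`,
`|det J_α(z)|² · f(αz) \overline{g(αz)} = (f ∥_3 α)(z) \overline{(g ∥_3 α)(z)}` — the Jacobian factor of
the change of variables `z ↦ αz` is exactly absorbed by the weight-3 slash. -/
theorem slash_three_mul_conj_slash {α : Matrix (Fin 3) (Fin 3) ℂ} (hα : IsInU21 α)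
    (f g : (Fin 2 → ℂ) → ℂ) {z : Fin 2 → ℂ} (hz : z ∈ ball₂) :
    slash 3 α f z * (starRingEnd ℂ) (slash 3 α g z) =
      ((‖(jacobian α z).det‖ ^ 2 : ℝ) : ℂ) * (f (ballAction α z) * (starRingEnd ℂ) (g (ballAction α z))) := by
  have hz' : ballAction α z ∈ ball₂ := IsInU21.ballAction_mem_ball₂ hα hz
  have e1 := peterssonPair_three_mul_volumeDensity (slash 3 α f) (slash 3 α g) hz
  have e2 := peterssonPair_three_mul_volumeDensity f g hz'
  have e3 := volumeDensity_ballAction hα hz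
  rw [peterssonPair_slash 3 hα f g hz] at e1
  rw [← e1, ← e2, ← e3]
  push_cast
  ring
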